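import Literature.AlgebraicGeometry.Resolution.LogRegularScheme

/-!
# Crux `CleanModelsSuffice` (stmt-ResolutionOfSingularities-15883), line `Sketch`: a log regular local ring with FREE chart monoid is regular

Kato 1994, remark after Def. (2.1) / Ex. (2.2)(1): if `(R, ℕⁿ)` is log regular at the closed point then `R` is a
regular local ring. Elementary count: with `S` the coordinates of `ℕⁿ` mapped to units, the face of units spans a
lattice of rank `≤ #S`, Kato's ideal `I` is generated by the `n − #S` non-unit coordinates, and `𝔪_R` is generated
by lifts of `dim R/I` generators of `𝔪_{R/I}` together with those coordinates, so
`μ(𝔪_R) ≤ dim R/I + (n − #S) ≤ dim R/I + (n − rk F) = dim R`.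

Used by the exceptionalisation game (local structure of the singular locus of the Kummer normalisation: a point
with at most one charged coordinate is regular). The free monoid is taken as a hypothesis `hP` (membership =
coordinatewise nonnegativity) rather than a definition.
-/

noncomputable section

set_option linter.dupNamespace false -- mandated namespace of this single-conjunct summit

open Literature.AlgebraicGeometry.Resolution IsLocalRing

namespace Summit.ResolutionOfSingularities.ResolutionOfSingularities.Theorems.RadicialJung.CleanModelsSuffice

/-- **Log regular with free monoid ⇒ regular.** If `P ⊆ ℤⁿ` is the orthant `ℕⁿ` (`hP`) and the chart
`φ : P → R` through the Noetherian local ring `R` is log regular in Kato's sense (`LogChart.IsLogRegularLocal`: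
`R ⧸ I(φ)` regular and `dim R = dim R/I(φ) + (n − rk Fᵍᵖ)`), then `R` is a regular local ring.
[cite: Kato1994, (2.2)(1)] -/
theorem isRegularLocalRing_of_isLogRegularLocal_free {R : Type} [CommRing R] [IsNoetherianRing R]
    [IsLocalRing R] {n : ℕ} (P : AddSubmonoid (Fin n → ℤ)) (hP : ∀ c, c ∈ P ↔ ∀ i, 0 ≤ c i)
    (φ : Multiplicative P →* R) (h : LogChart.IsLogRegularLocal P φ) : IsRegularLocalRing R := by
  classical
  -- unit vectors and coordinates
  have he : ∀ i : Fin n, (Pi.single i (1 : ℤ) : Fin n → ℤ) ∈ P := fun i => (hP _).2 fun j => by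
    by_cases hij : j = i
    · subst hij; simp
    · simp [hij]
  let e : Fin n → P := fun i => ⟨Pi.single i 1, he i⟩
  let x : Fin n → R := fun i => φ (Multiplicative.ofAdd (e i))
  have hx : ∀ i, x i = φ (Multiplicative.ofAdd (e i)) := fun _ => rfl
  -- every element of `P` is the nonnegative combination of the unit vectors
  have hvec : ∀ c : Fin n → ℤ, (∀ i, 0 ≤ c i) →
      c = ∑ i, (c i).toNat • (Pi.single i (1 : ℤ) : Fin n → ℤ) := by
    intro c hc
    funext j
    rw [Finset.sum_apply]
    simp only [Pi.smul_apply, Pi.single_apply, smul_ite, smul_zero, nsmul_one, Finset.sum_ite_eq,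
      Finset.mem_univ, if_true]
    exact (Int.toNat_of_nonneg (hc j)).symm
  have hsum : ∀ c : P, c = ∑ i, ((c : Fin n → ℤ) i).toNat • e i := by
    intro c
    apply Subtype.ext
    change P.subtype c = P.subtype (∑ i, ((c : Fin n → ℤ) i).toNat • e i)
    rw [map_sum]
    simp only [map_nsmul, AddSubmonoid.subtype_apply]
    exact hvec c ((hP _).1 c.2)
  have hdecomp : ∀ c : P, φ (Multiplicative.ofAdd c) = ∏ i, x i ^ ((c : Fin n → ℤ) i).toNat := by
    intro c
    conv_lhs => rw [hsum c]
    rw [ofAdd_sum, map_prod]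
    refine Finset.prod_congr rfl fun i _ => ?_
    rw [ofAdd_nsmul, map_pow]
  -- indices of unit coordinates
  set S : Finset (Fin n) := Finset.univ.filter fun i => IsUnit (x i) with hS
  have hmemS : ∀ i, i ∈ S ↔ IsUnit (x i) := fun i => by simp [hS]
  -- (1) the face of units lies in the span of the unit vectors indexed by `S`
  have hcoord : ∀ c : P, IsUnit (φ (Multiplicative.ofAdd c)) → ∀ i, i ∉ S → (c : Fin n → ℤ) i = 0 := by
    intro c hc i hi
    by_contra hne
    have hci : 0 ≤ (c : Fin n → ℤ) i := (hP _).1 c.2 i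
    have hpos : ((c : Fin n → ℤ) i).toNat ≠ 0 := by
      intro h0
      exact hne (le_antisymm (Int.toNat_eq_zero.1 h0) hci)
    rw [hdecomp, ← Finset.mul_prod_erase _ _ (Finset.mem_univ i)] at hc
    have hxi : IsUnit (x i) := (isUnit_pow_iff hpos).1 (isUnit_of_mul_isUnit_left hc)
    exact hi ((hmemS i).2 hxi)
  have hF : Submodule.span ℤ ((fun q : P => (q : Fin n → ℤ)) '' LogChart.unitFace P φ) ≤
      Submodule.span ℤ (((S.image fun i => (Pi.single i (1 : ℤ) : Fin n → ℤ)) : Finset (Fin n → ℤ)) :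
        Set (Fin n → ℤ)) := by
    rw [Submodule.span_le]
    rintro _ ⟨c, hc, rfl⟩
    change (c : Fin n → ℤ) ∈ _
    have hc' : IsUnit (φ (Multiplicative.ofAdd c)) := hc
    have hcS : (c : Fin n → ℤ) = ∑ i ∈ S, (c : Fin n → ℤ) i • (Pi.single i (1 : ℤ) : Fin n → ℤ) := by
      funext j
      simp only [Finset.sum_apply, Pi.smul_apply, Pi.single_apply, smul_eq_mul, mul_ite, mul_one,
        mul_zero]
      rw [Finset.sum_ite_eq S j (fun i => (c : Fin n → ℤ) i)]
      by_cases hj : j ∈ S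
      · simp [hj]
      · simp [hj, hcoord c hc' j hj]
    rw [SetLike.mem_coe, hcS]
    refine Submodule.sum_mem _ fun i hi => Submodule.smul_mem _ _ (Submodule.subset_span ?_)
    simp only [Finset.coe_image]
    exact ⟨i, hi, rfl⟩
  have hrankF : Module.finrank ℤ
      (Submodule.span ℤ ((fun q : P => (q : Fin n → ℤ)) '' LogChart.unitFace P φ)) ≤ S.card := by
    refine (Submodule.finrank_mono hF).trans ?_
    refine (finrank_span_finset_le_card (R := ℤ)
      (S.image fun i => (Pi.single i (1 : ℤ) : Fin n → ℤ))).trans Finset.card_image_le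
  -- (2) Kato's ideal is contained in the ideal of the non-unit coordinates
  set I : Ideal R := LogChart.nonunitIdeal P φ with hI
  set G : Set R := x '' ((Sᶜ : Finset (Fin n)) : Set (Fin n)) with hG
  have hGfin : G.Finite := (Finset.finite_toSet _).image _
  have hGcard : G.ncard ≤ n - S.card := by
    refine (Set.ncard_image_le (Finset.finite_toSet _)).trans ?_
    rw [Set.ncard_coe_finset, Finset.card_compl, Fintype.card_fin]
  have hIG : I ≤ Ideal.span G := by
    rw [hI, LogChart.nonunitIdeal, Ideal.span_le]
    rintro _ ⟨c, hc, rfl⟩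
    change φ (Multiplicative.ofAdd c) ∈ Ideal.span G
    have hc' : ¬ IsUnit (φ (Multiplicative.ofAdd c)) := hc
    by_cases hex : ∃ i, i ∉ S ∧ ((c : Fin n → ℤ) i).toNat ≠ 0
    · obtain ⟨i, hiS, hci⟩ := hex
      rw [hdecomp, ← Finset.mul_prod_erase _ _ (Finset.mem_univ i)]
      refine Ideal.mul_mem_right _ _ (Ideal.pow_mem_of_mem _ (Ideal.subset_span ?_) _
        (Nat.pos_of_ne_zero hci))
      exact ⟨i, by simpa using hiS, rfl⟩
    · exfalso
      apply hc'
      rw [hdecomp]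
      refine IsUnit.prod_univ_iff.mpr fun i => ?_
      by_cases hiS : i ∈ S
      · exact ((hmemS i).1 hiS).pow _
      · have h0 : ((c : Fin n → ℤ) i).toNat = 0 := by
          by_contra h0; exact hex ⟨i, hiS, h0⟩
        rw [h0, pow_zero]; exact isUnit_one
  have hGm : Ideal.span G ≤ maximalIdeal R := by
    rw [Ideal.span_le]
    rintro _ ⟨i, hi, rfl⟩
    have hiS : i ∉ S := by simpa using hi
    exact (mem_maximalIdeal _).2 (mem_nonunits_iff.2 fun hu => hiS ((hmemS i).2 hu))
  -- (3) generators of `𝔪_R`: lifts of generators of `𝔪_{R/I}` together with `G`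
  haveI : IsRegularLocalRing (R ⧸ I) := h.1
  have hItop : I ≠ ⊤ := by
    intro htop
    have : (maximalIdeal R) = ⊤ := top_le_iff.1 (htop ▸ hIG.trans hGm)
    exact (maximalIdeal.isMaximal R).ne_top this
  haveI : Nontrivial (R ⧸ I) := Ideal.Quotient.nontrivial_iff.mpr hItop
  haveI := IsLocalHom.of_surjective (Ideal.Quotient.mk I) Ideal.Quotient.mk_surjective
  have fgbar : (maximalIdeal (R ⧸ I)).FG := (maximalIdeal _).fg_of_isNoetherianRing
  set Tbar : Set (R ⧸ I) := (maximalIdeal (R ⧸ I)).generators with hTbar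
  have hTbar_fin : Tbar.Finite := Submodule.FG.finite_generators fgbar
  have hTbar_span : Ideal.span Tbar = maximalIdeal (R ⧸ I) := (maximalIdeal (R ⧸ I)).span_generators
  have hTbar_card : (Tbar.ncard : WithBot ℕ∞) = ringKrullDim (R ⧸ I) := by
    rw [hTbar, Submodule.FG.generators_ncard fgbar]
    exact IsRegularLocalRing.spanFinrank_maximalIdeal
  -- lifts
  let lift : R ⧸ I → R := fun t => (Ideal.Quotient.mk_surjective t).choose
  have hlift : ∀ t, Ideal.Quotient.mk I (lift t) = t := fun t => (Ideal.Quotient.mk_surjective t).choose_spec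
  set T : Set R := lift '' Tbar with hT
  have hTfin : T.Finite := hTbar_fin.image _
  have hTcard : T.ncard ≤ Tbar.ncard := Set.ncard_image_le hTbar_fin
  have hmkT : Ideal.Quotient.mk I '' T = Tbar := by
    rw [hT, Set.image_image]
    simp only [hlift, Set.image_id']
  have hmax : maximalIdeal R = Ideal.span (T ∪ G) := by
    apply le_antisymm
    · intro r hr
      have hr' : Ideal.Quotient.mk I r ∈ maximalIdeal (R ⧸ I) := map_nonunit (Ideal.Quotient.mk I) r hr
      rw [← hTbar_span, ← hmkT, ← Ideal.map_span] at hr'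
      have hr'' : r ∈ (Ideal.map (Ideal.Quotient.mk I) (Ideal.span T)).comap (Ideal.Quotient.mk I) :=
        Ideal.mem_comap.2 hr'
      rw [Ideal.comap_map_of_surjective _ Ideal.Quotient.mk_surjective, ← RingHom.ker_eq_comap_bot,
        Ideal.mk_ker] at hr''
      rw [Ideal.span_union]
      exact (sup_le_sup_left (hIG) _) hr''
    · rw [Ideal.span_union, sup_le_iff]
      refine ⟨?_, hGm⟩
      rw [Ideal.span_le]
      rintro _ ⟨t, ht, rfl⟩
      refine (mem_maximalIdeal _).2 (mem_nonunits_iff.2 fun hu => ?_)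
      have htm : t ∈ maximalIdeal (R ⧸ I) := hTbar_span ▸ Ideal.subset_span ht
      exact mem_nonunits_iff.1 ((mem_maximalIdeal _).1 htm)
        (by simpa [hlift] using hu.map (Ideal.Quotient.mk I))
  -- (4) the count
  refine IsRegularLocalRing.of_spanFinrank_maximalIdeal_le R ?_
  have hμ : (maximalIdeal R).spanFinrank ≤ Tbar.ncard + (n - S.card) := by
    rw [hmax]
    refine (Submodule.spanFinrank_span_le_ncard_of_finite (hTfin.union hGfin)).trans ?_
    refine (Set.ncard_union_le _ _).trans ?_
    exact add_le_add hTcard hGcard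
  have hsub : n - S.card ≤ n - Module.finrank ℤ
      (Submodule.span ℤ ((fun q : P => (q : Fin n → ℤ)) '' LogChart.unitFace P φ)) :=
    Nat.sub_le_sub_left hrankF n
  calc ((maximalIdeal R).spanFinrank : WithBot ℕ∞)
      ≤ ((Tbar.ncard + (n - S.card) : ℕ) : WithBot ℕ∞) := by exact_mod_cast hμ
    _ ≤ ((Tbar.ncard : ℕ) : WithBot ℕ∞) + ((n - Module.finrank ℤ
          (Submodule.span ℤ ((fun q : P => (q : Fin n → ℤ)) '' LogChart.unitFace P φ)) : ℕ) :
            WithBot ℕ∞) := by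
        push_cast
        exact add_le_add le_rfl (by exact_mod_cast hsub)
    _ = ringKrullDim (R ⧸ I) + ((n - Module.finrank ℤ
          (Submodule.span ℤ ((fun q : P => (q : Fin n → ℤ)) '' LogChart.unitFace P φ)) : ℕ) :
            WithBot ℕ∞) := by rw [hTbar_card]
    _ = ringKrullDim R := h.2.symm

end Summit.ResolutionOfSingularities.ResolutionOfSingularities.Theorems.RadicialJung.CleanModelsSuffice

end
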